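import Mathlib
import HarnessLib
import Summits.ValiantsHypothesis.ValiantsHypothesis.Theorems.LacunarySymmetroidMatrixDescartesProductPlusOneLetterVariance

/-!
# ValiantsHypothesis / LacunarySymmetroid — crux `MatrixDescartes` (stmt-ValiantsHypothesis-18050, V1),
# LINE (A) «product_plus_one», every-K side: the THREE-LETTER RISER CELL is SHARP — a K = 4 member with FIVE zeros on one riser window

val-idea-25 g3's label (HOME/STATUS 01:33:35Z) «THREE-LETTER RISER CELL (K = 4): one incoherent three-letter row vs any unswitched incoherent cloud ⇒ ≤ 5
zeros of `eulerNumerator d a 0` on (0, t_min)» (val-lit-p5 g15 memo `pub/val-lit/lmr/NOTE-p5g15-18050-LINEA-K4-oneSigned-riser.md` §4, PAPER THEOREM).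
This file is the kernel SHARPNESS datum (the memo's certificate 3, exact rationals): support `d = (0, 1, 8, 41)`, `m = 4` rows — the switched
three-letter riser `f₀ = 1/20000 − x/1000 − x⁸/25 − (69/8)·x⁴¹` (pattern (+,−,−,−), root `t₀ ≈ 0.05`) and three copies of the binomial puller `1 − x`
(pattern (+,−,0,0), root `1 = t_min`):

* `sharpMember_rows_eval` — the four rows at a point; `sharpMember_riser_neg` — the riser is SWITCHED on `[1/5, 1)`; the pullers are unswitched on `(0,1)`;
* `sharpMember_euler_sign_*` — exact signs of `eulerNumerator d a 0` at `x = 1/5, 2/5, 3/5, 3/4, 7/8, 19/20`: `− + − + − +` (`norm_num`);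
* ★ `threeLetterRiser_five_zeros` — hence FIVE distinct zeros of `eulerNumerator d a 0` in `(1/5, 19/20) ⊂ (t₀, t_min)` (intermediate value theorem ×5):
  the two-letter count «≤ 3 per window» (✓ `oneRiser_trinomialCloud_eulerNumerator_no_four_zeros`, K = 3) does NOT extend to three letters, and the
  paper bound 5 of the memo is attained.

HONEST FRAMING: one explicit member, kernel-evaluated; a located datum for the every-K programme (S5); the K = 3 floor `OneChangeFloorK3` is NOT affected;
nothing here is a stub or closes anything; `VP ≠ VNP` is NOT proved.  No definitions, no named facts; Mathlib + ✓ `…LetterVariance` (evaluation lemmas) only.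
-/

set_option linter.dupNamespace false

namespace Summit.ValiantsHypothesis.ValiantsHypothesis.Theorems.LacunarySymmetroidMatrixDescartes

namespace ProductPlusOne

open Polynomial Finset
open scoped BigOperators

/-- The rows of the sharp member, evaluated: row 0 is the riser, rows 1–3 are `1 − t`. [this file's lemma] -/
theorem sharpMember_rows_eval (t : ℝ) (j : Fin 4) :
    (∑ l, C ((![![(1 : ℝ) / 20000, -1 / 1000, -1 / 25, -69 / 8], ![1, -1, 0, 0], ![1, -1, 0, 0], ![1, -1, 0, 0]]
        : Fin 4 → Fin 4 → ℝ) j l) * X ^ ((![0, 1, 8, 41] : Fin 4 → ℕ) l) : ℝ[X]).eval t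
      = (![1 / 20000 - t / 1000 - t ^ 8 / 25 - 69 / 8 * t ^ 41, 1 - t, 1 - t, 1 - t] : Fin 4 → ℝ) j := by
  rw [eval_fewnomial]
  fin_cases j
  · simp [Fin.sum_univ_four]; ring
  · simp [Fin.sum_univ_four]; ring
  · simp [Fin.sum_univ_four]; ring
  · simp [Fin.sum_univ_four]; ring

/-- The Euler letters of the rows (bottom coupling), evaluated. [this file's lemma] -/
theorem sharpMember_euler_rows_eval (t : ℝ) (j : Fin 4) :
    (X * derivative (∑ l, C ((![![(1 : ℝ) / 20000, -1 / 1000, -1 / 25, -69 / 8], ![1, -1, 0, 0], ![1, -1, 0, 0], ![1, -1, 0, 0]]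
        : Fin 4 → Fin 4 → ℝ) j l) * X ^ ((![0, 1, 8, 41] : Fin 4 → ℕ) l) : ℝ[X])
        - C ((((![0, 1, 8, 41] : Fin 4 → ℕ) 0 : ℕ) : ℝ))
          * ∑ l, C ((![![(1 : ℝ) / 20000, -1 / 1000, -1 / 25, -69 / 8], ![1, -1, 0, 0], ![1, -1, 0, 0], ![1, -1, 0, 0]]
            : Fin 4 → Fin 4 → ℝ) j l) * X ^ ((![0, 1, 8, 41] : Fin 4 → ℕ) l)).eval t
      = (![-t / 1000 - 8 * t ^ 8 / 25 - 41 * 69 / 8 * t ^ 41, -t, -t, -t] : Fin 4 → ℝ) j := by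
  rw [euler_fewnomial, eval_fewnomial]
  fin_cases j
  · simp [Fin.sum_univ_four]; ring
  · simp [Fin.sum_univ_four]
  · simp [Fin.sum_univ_four]
  · simp [Fin.sum_univ_four]

/-- The riser row is SWITCHED (negative) at every `t ≥ 1/5`. [this file's lemma] -/
theorem sharpMember_riser_neg {t : ℝ} (ht : 1 / 5 ≤ t) :
    (1 : ℝ) / 20000 - t / 1000 - t ^ 8 / 25 - 69 / 8 * t ^ 41 < 0 := by
  have h8 : 0 ≤ t ^ 8 := by positivity
  have h41 : 0 ≤ t ^ 41 := pow_nonneg (by linarith) _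
  nlinarith

/-- **The Euler numerator of the sharp member at a point `t ∈ [1/5, 1)`** through the row values (✓ `eval_eulerNumerator_eq_prod_mul_sum`). [this file's lemma] -/
theorem sharpMember_euler_eval {t : ℝ} (ht : 1 / 5 ≤ t) (ht1 : t < 1) :
    (∑ j, (∑ l, C ((![![(1 : ℝ) / 20000, -1 / 1000, -1 / 25, -69 / 8], ![1, -1, 0, 0], ![1, -1, 0, 0], ![1, -1, 0, 0]]
          : Fin 4 → Fin 4 → ℝ) j l * ((((![0, 1, 8, 41] : Fin 4 → ℕ) l : ℕ) : ℝ) - (((![0, 1, 8, 41] : Fin 4 → ℕ) 0 : ℕ) : ℝ)))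
          * X ^ ((![0, 1, 8, 41] : Fin 4 → ℕ) l)) *
        ∏ i ∈ Finset.univ.erase j, (∑ l, C ((![![(1 : ℝ) / 20000, -1 / 1000, -1 / 25, -69 / 8], ![1, -1, 0, 0], ![1, -1, 0, 0],
          ![1, -1, 0, 0]] : Fin 4 → Fin 4 → ℝ) i l) * X ^ ((![0, 1, 8, 41] : Fin 4 → ℕ) l)) : ℝ[X]).eval t
      = ((1 / 20000 - t / 1000 - t ^ 8 / 25 - 69 / 8 * t ^ 41) * (1 - t) * (1 - t) * (1 - t))
        * ((-t / 1000 - 8 * t ^ 8 / 25 - 41 * 69 / 8 * t ^ 41) / (1 / 20000 - t / 1000 - t ^ 8 / 25 - 69 / 8 * t ^ 41)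
            + -t / (1 - t) + -t / (1 - t) + -t / (1 - t)) := by
  have hF := sharpMember_riser_neg ht
  have hf : ∀ j, (∑ l, C ((![![(1 : ℝ) / 20000, -1 / 1000, -1 / 25, -69 / 8], ![1, -1, 0, 0], ![1, -1, 0, 0], ![1, -1, 0, 0]]
        : Fin 4 → Fin 4 → ℝ) j l) * X ^ ((![0, 1, 8, 41] : Fin 4 → ℕ) l) : ℝ[X]).eval t ≠ 0 := by
    intro j
    rw [sharpMember_rows_eval]
    fin_cases j <;> simp <;> intro h <;> linarith
  rw [eval_eulerNumerator_eq_prod_mul_sum _ _ 0 hf]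
  simp only [sharpMember_rows_eval, sharpMember_euler_rows_eval]
  simp only [Fin.prod_univ_four, Fin.sum_univ_four, Matrix.cons_val_zero, Matrix.cons_val_one, Matrix.cons_val_two,
    Matrix.cons_val_three, Matrix.head_cons, Matrix.tail_cons]

/-- Exact signs of the Euler numerator at the six rational points `1/5, 2/5, 3/5, 3/4, 7/8, 19/20`: `− + − + − +`. [this file's lemma] -/
theorem sharpMember_euler_signs :
    (∀ t ∈ ({1 / 5, 3 / 5, 7 / 8} : Set ℝ),
      (∑ j, (∑ l, C ((![![(1 : ℝ) / 20000, -1 / 1000, -1 / 25, -69 / 8], ![1, -1, 0, 0], ![1, -1, 0, 0], ![1, -1, 0, 0]]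
          : Fin 4 → Fin 4 → ℝ) j l * ((((![0, 1, 8, 41] : Fin 4 → ℕ) l : ℕ) : ℝ) - (((![0, 1, 8, 41] : Fin 4 → ℕ) 0 : ℕ) : ℝ)))
          * X ^ ((![0, 1, 8, 41] : Fin 4 → ℕ) l)) *
        ∏ i ∈ Finset.univ.erase j, (∑ l, C ((![![(1 : ℝ) / 20000, -1 / 1000, -1 / 25, -69 / 8], ![1, -1, 0, 0], ![1, -1, 0, 0],
          ![1, -1, 0, 0]] : Fin 4 → Fin 4 → ℝ) i l) * X ^ ((![0, 1, 8, 41] : Fin 4 → ℕ) l)) : ℝ[X]).eval t < 0) ∧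
    (∀ t ∈ ({2 / 5, 3 / 4, 19 / 20} : Set ℝ), 0 <
      (∑ j, (∑ l, C ((![![(1 : ℝ) / 20000, -1 / 1000, -1 / 25, -69 / 8], ![1, -1, 0, 0], ![1, -1, 0, 0], ![1, -1, 0, 0]]
          : Fin 4 → Fin 4 → ℝ) j l * ((((![0, 1, 8, 41] : Fin 4 → ℕ) l : ℕ) : ℝ) - (((![0, 1, 8, 41] : Fin 4 → ℕ) 0 : ℕ) : ℝ)))
          * X ^ ((![0, 1, 8, 41] : Fin 4 → ℕ) l)) *
        ∏ i ∈ Finset.univ.erase j, (∑ l, C ((![![(1 : ℝ) / 20000, -1 / 1000, -1 / 25, -69 / 8], ![1, -1, 0, 0], ![1, -1, 0, 0],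
          ![1, -1, 0, 0]] : Fin 4 → Fin 4 → ℝ) i l) * X ^ ((![0, 1, 8, 41] : Fin 4 → ℕ) l)) : ℝ[X]).eval t) := by
  constructor
  · intro t ht
    simp only [Set.mem_insert_iff, Set.mem_singleton_iff] at ht
    rcases ht with rfl | rfl | rfl <;> (rw [sharpMember_euler_eval (by norm_num) (by norm_num)]; norm_num)
  · intro t ht
    simp only [Set.mem_insert_iff, Set.mem_singleton_iff] at ht
    rcases ht with rfl | rfl | rfl <;> (rw [sharpMember_euler_eval (by norm_num) (by norm_num)]; norm_num)

/-- ★ **THE THREE-LETTER RISER CELL IS SHARP:** the K = 4 member above has FIVE distinct zeros of `eulerNumerator d a 0` in `(1/5, 19/20)`, a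
sub-interval of its riser window `(t₀, t_min) = (t₀, 1)` (riser switched, pullers unswitched there).  So «≤ 3 per window» (two letters, K = 3) does
not extend to three letters, and the paper bound «≤ 5» (val-lit-p5 g15 memo §4) is attained. [this file's theorem] -/
theorem threeLetterRiser_five_zeros :
    ∃ x₁ x₂ x₃ x₄ x₅ : ℝ, 1 / 5 < x₁ ∧ x₁ < x₂ ∧ x₂ < x₃ ∧ x₃ < x₄ ∧ x₄ < x₅ ∧ x₅ < 19 / 20 ∧
      ∀ x ∈ ({x₁, x₂, x₃, x₄, x₅} : Set ℝ),
        (∑ j, (∑ l, C ((![![(1 : ℝ) / 20000, -1 / 1000, -1 / 25, -69 / 8], ![1, -1, 0, 0], ![1, -1, 0, 0], ![1, -1, 0, 0]]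
            : Fin 4 → Fin 4 → ℝ) j l * ((((![0, 1, 8, 41] : Fin 4 → ℕ) l : ℕ) : ℝ) - (((![0, 1, 8, 41] : Fin 4 → ℕ) 0 : ℕ) : ℝ)))
            * X ^ ((![0, 1, 8, 41] : Fin 4 → ℕ) l)) *
          ∏ i ∈ Finset.univ.erase j, (∑ l, C ((![![(1 : ℝ) / 20000, -1 / 1000, -1 / 25, -69 / 8], ![1, -1, 0, 0], ![1, -1, 0, 0],
            ![1, -1, 0, 0]] : Fin 4 → Fin 4 → ℝ) i l) * X ^ ((![0, 1, 8, 41] : Fin 4 → ℕ) l)) : ℝ[X]).eval x = 0 := by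
  obtain ⟨hneg, hpos⟩ := sharpMember_euler_signs
  set R : ℝ[X] := (∑ j, (∑ l, C ((![![(1 : ℝ) / 20000, -1 / 1000, -1 / 25, -69 / 8], ![1, -1, 0, 0], ![1, -1, 0, 0], ![1, -1, 0, 0]]
            : Fin 4 → Fin 4 → ℝ) j l * ((((![0, 1, 8, 41] : Fin 4 → ℕ) l : ℕ) : ℝ) - (((![0, 1, 8, 41] : Fin 4 → ℕ) 0 : ℕ) : ℝ)))
            * X ^ ((![0, 1, 8, 41] : Fin 4 → ℕ) l)) *
          ∏ i ∈ Finset.univ.erase j, (∑ l, C ((![![(1 : ℝ) / 20000, -1 / 1000, -1 / 25, -69 / 8], ![1, -1, 0, 0], ![1, -1, 0, 0],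
            ![1, -1, 0, 0]] : Fin 4 → Fin 4 → ℝ) i l) * X ^ ((![0, 1, 8, 41] : Fin 4 → ℕ) l)) : ℝ[X]) with hRdef
  have hcont : Continuous fun t => R.eval t := R.continuous
  have h1 : R.eval (1 / 5) < 0 := hneg _ (by simp)
  have h2 : 0 < R.eval (2 / 5) := hpos _ (by simp)
  have h3 : R.eval (3 / 5) < 0 := hneg _ (by simp)
  have h4 : 0 < R.eval (3 / 4) := hpos _ (by simp)
  have h5 : R.eval (7 / 8) < 0 := hneg _ (by simp)
  have h6 : 0 < R.eval (19 / 20) := hpos _ (by norm_num)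
  -- five sign changes ⇒ five zeros (intermediate value theorem)
  obtain ⟨x₁, hx₁, e₁⟩ := intermediate_value_Ioo (show (1 : ℝ) / 5 ≤ 2 / 5 by norm_num) hcont.continuousOn ⟨h1, h2⟩
  obtain ⟨x₂, hx₂, e₂⟩ := intermediate_value_Ioo' (show (2 : ℝ) / 5 ≤ 3 / 5 by norm_num) hcont.continuousOn ⟨h3, h2⟩
  obtain ⟨x₃, hx₃, e₃⟩ := intermediate_value_Ioo (show (3 : ℝ) / 5 ≤ 3 / 4 by norm_num) hcont.continuousOn ⟨h3, h4⟩
  obtain ⟨x₄, hx₄, e₄⟩ := intermediate_value_Ioo' (show (3 : ℝ) / 4 ≤ 7 / 8 by norm_num) hcont.continuousOn ⟨h5, h4⟩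
  obtain ⟨x₅, hx₅, e₅⟩ := intermediate_value_Ioo (show (7 : ℝ) / 8 ≤ 19 / 20 by norm_num) hcont.continuousOn ⟨h5, h6⟩
  refine ⟨x₁, x₂, x₃, x₄, x₅, hx₁.1, hx₁.2.trans hx₂.1, hx₂.2.trans hx₃.1, hx₃.2.trans hx₄.1, hx₄.2.trans hx₅.1, hx₅.2, ?_⟩
  intro x hx
  simp only [Set.mem_insert_iff, Set.mem_singleton_iff] at hx
  rcases hx with rfl | rfl | rfl | rfl | rfl
  exacts [e₁, e₂, e₃, e₄, e₅]

end ProductPlusOne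

end Summit.ValiantsHypothesis.ValiantsHypothesis.Theorems.LacunarySymmetroidMatrixDescartes
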